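import Literature.NumberTheory.CubicFields.CubicFieldGaloisIffSquareDiscriminant
import Mathlib.NumberTheory.NumberField.Discriminant.Basic
import Mathlib.NumberTheory.NumberField.InfinitePlace.TotallyRealComplex
import HarnessLib

/-!
# The signature of a cubic number field from the SIGN of its field discriminant (Brill), and «cyclic cubics are totally real»

Topic `NumberTheory/CubicFields`; namespace `Literature.NumberTheory.CubicFields`. Theorem-only file (no definition, no named fact, no `sorry`),
written by the prover seat `bsd-line-att-p4` g33 (cell `bsd-f1-sign2`, `--supports` stmt-BirchSwinnertonDyer-22298; closes nothing there). INTRINSIC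
companion of `NumberFields/CubicField{OneRealPlace,ThreeRealPlaces}` (which read the signature off the sign of the discriminant of a generating
POLYNOMIAL): here the FIELD discriminant `d_F = NumberField.discr F`, via Brill's theorem `sign d_F = (−1)^{r₂}` (Mathlib `NumberField.sign_discr`).

* `isTotallyReal_iff_discr_pos_of_finrank_eq_three` — **`[F:ℚ] = 3`: `F` totally real ⟺ `d_F > 0`**; `nrRealPlaces_eq_one_iff_discr_neg_of_finrank_eq_three`
  — **exactly one real place ⟺ `d_F < 0`** (`r₂ ∈ {0, 1}` for a cubic).
* `isTotallyReal_of_isGalois_cubic` — **a cyclic (Galois) cubic field is totally real** (`d_F` is a square, `CubicFieldGaloisIffSquareDiscriminant`);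
  `not_isGalois_of_discr_neg_cubic` — a cubic field of negative discriminant is not Galois (an `S₃`-cubic).

## References

* H. Cohen, *A Course in Computational Algebraic Number Theory*, GTM 138, Prop. 4.8.11 (`sign d(K) = (−1)^{r₂}`, Brill) and §6.3.3. [Cohen1993]
* D. A. Marcus, *Number Fields*, 2nd ed., Ch. 2 (exercise: sign of the discriminant). [Marcus2018]
-/

noncomputable section

open NumberField NumberField.InfinitePlace Module

namespace Literature.NumberTheory.CubicFields

variable (F : Type) [Field F] [NumberField F]

/-- For a cubic field, `r₂ ≤ 1` and `r₁ + 2r₂ = 3`. [cite: Cohen1993, §4.1.3] -/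
theorem nrComplexPlaces_le_one_of_finrank_eq_three (hF : finrank ℚ F = 3) : nrComplexPlaces F ≤ 1 := by
  have h := card_add_two_mul_card_eq_rank F
  rw [hF] at h
  omega

/-- ★ **Brill for cubics: `F` totally real ⟺ `d_F > 0`** (`[F:ℚ] = 3`; `sign d_F = (−1)^{r₂}`, `r₂ ∈ {0,1}`).
[cite: Cohen1993, Prop. 4.8.11 (`sign d(K) = (−1)^{r₂}`)] [cite: Marcus2018, Ch. 2] -/
theorem isTotallyReal_iff_discr_pos_of_finrank_eq_three (hF : finrank ℚ F = 3) : IsTotallyReal F ↔ 0 < discr F := by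
  have hsign := NumberField.sign_discr F
  have hle := nrComplexPlaces_le_one_of_finrank_eq_three F hF
  constructor
  · intro hT
    rw [IsTotallyReal.nrComplexPlaces_eq_zero F, pow_zero] at hsign
    exact Int.sign_eq_one_iff_pos.mp hsign
  · intro hpos
    rw [Int.sign_eq_one_of_pos hpos] at hsign
    have h0 : nrComplexPlaces F = 0 := by
      rcases Nat.le_one_iff_eq_zero_or_eq_one.mp hle with h | h
      · exact h
      · rw [h, pow_one] at hsign; norm_num at hsign
    exact NumberField.nrComplexPlaces_eq_zero_iff.mp h0

/-- ★ **`F` cubic NOT totally real ⟺ `d_F < 0`** (then `F` has exactly one real place). [cite: Cohen1993, Prop. 4.8.11] [cite: Marcus2018, Ch. 2] -/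
theorem not_isTotallyReal_iff_discr_neg_of_finrank_eq_three (hF : finrank ℚ F = 3) : ¬ IsTotallyReal F ↔ discr F < 0 := by
  rw [isTotallyReal_iff_discr_pos_of_finrank_eq_three F hF, not_lt]
  exact ⟨fun h ↦ lt_of_le_of_ne h (discr_ne_zero F), fun h ↦ h.le⟩

/-- **Exactly one real place ⟺ `d_F < 0`**, for a cubic field. [cite: Cohen1993, Prop. 4.8.11 and §4.1.3] -/
theorem nrRealPlaces_eq_one_iff_discr_neg_of_finrank_eq_three (hF : finrank ℚ F = 3) : nrRealPlaces F = 1 ↔ discr F < 0 := by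
  rw [← not_isTotallyReal_iff_discr_neg_of_finrank_eq_three F hF, ← NumberField.nrComplexPlaces_eq_zero_iff]
  have h := card_add_two_mul_card_eq_rank F
  rw [hF] at h
  omega

/-- ★ **A cyclic (Galois) cubic field is totally real**: its discriminant is a square (`isSquare_discr_of_isGalois_cubic`), hence positive.
[cite: Cohen1993, §6.3.3 and Prop. 4.8.11] [cite: Marcus2018, Ch. 2] -/
theorem isTotallyReal_of_isGalois_cubic (hF : finrank ℚ F = 3) [IsGalois ℚ F] : IsTotallyReal F := by
  obtain ⟨r, hr⟩ := isSquare_discr_of_isGalois_cubic F hF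
  rw [isTotallyReal_iff_discr_pos_of_finrank_eq_three F hF]
  have h0 : discr F ≠ 0 := discr_ne_zero F
  rw [hr] at h0 ⊢
  have hr0 : r ≠ 0 := fun h ↦ h0 (by rw [h, mul_zero])
  exact mul_self_pos.mpr hr0

/-- **A cubic field of NEGATIVE discriminant is not Galois over `ℚ`** (it is an `S₃`-cubic). [cite: Cohen1993, §6.3.3 and Prop. 4.8.11] -/
theorem not_isGalois_of_discr_neg_cubic (hF : finrank ℚ F = 3) (hd : discr F < 0) : ¬ IsGalois ℚ F := by
  intro hG
  have hT := isTotallyReal_of_isGalois_cubic F hF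
  exact absurd hd (not_lt.mpr ((isTotallyReal_iff_discr_pos_of_finrank_eq_three F hF).mp hT).le)

end Literature.NumberTheory.CubicFields

end
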